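import Literature.ModelTheory.ExponentialFields.DefinablyCompleteMeanValue
import HarnessLib

/-!
# Differentiable functions on `Kⁿ`: partial derivatives, continuity, linearity, and the chain rule along curves

Topic `Literature/ModelTheory/ExponentialFields`.  Continuation of `DefinablyCompleteMeanValue.lean`
(`C¹` calculus of functions `Kⁿ → K` over an ordered field `K`, for the definable analysis of
the models of `OEF ∪ [DC]`; Fornasiero–Servi 2010, §1.2).  For the norm-free differentiability
predicate `HasLinDerivAt f g x` (`|f (x + h) - f x - Σ gᵢ hᵢ| ≤ ε Σ |hᵢ|` for small `h`):

* `HasLinDerivAt.hasPartialDerivAt` — the gradient consists of the partial derivatives;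
* `HasLinDerivAt.continuousAt` — differentiable functions are continuous (product topology);
* `HasLinDerivAt.add`, `HasLinDerivAt.const_mul`, `hasLinDerivAt_const` — linearity;
* **`HasLinDerivAt.comp_curve`** — the *chain rule along a curve*: if `γ : K → Kⁿ` has
  coordinate derivatives `γ'ᵢ` at `t₀` (`HasFieldDerivAt`) and `f` is differentiable at `γ t₀`
  with gradient `g`, then `t ↦ f (γ t)` has derivative `Σ gᵢ γ'ᵢ` at `t₀` — the tool by which
  one-variable results (Rolle, mean value, monotonicity: `DefinablyCompleteCalculus.lean`) are
  applied along definable curves in `Kⁿ` (Khovanskii–Wilkie arguments, Fornasiero–Servi 2010,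
  §8.2).

No definable completeness is needed in this file (pure `ε`–`δ` calculus in an ordered field with
its order topology).  Everything is proved; no definitions.

## References

* A. Fornasiero, T. Servi, *Definably complete Baire structures*, Fund. Math. 209 (2010),
  §1.2, §8.2. [FornasieroServi2010]
-/

open Set Function
open _root_.Filter _root_.Topology

namespace Literature.ModelTheory.ExponentialFields

variable {K : Type*} [Field K] [LinearOrder K] [IsStrictOrderedRing K] [TopologicalSpace K]
  [OrderTopology K] {n : ℕ}

/-! ### Coordinate increments -/

omit [TopologicalSpace K] [OrderTopology K] [LinearOrder K] [IsStrictOrderedRing K] in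
/-- `x + (t in the i-th slot, 0 elsewhere) = update x i (x i + t)`. [folklore] -/
theorem add_single_eq_update (x : Fin n → K) (i : Fin n) (t : K) :
    x + Pi.single i t = update x i (x i + t) := by
  funext j
  by_cases hj : j = i
  · subst hj; simp
  · simp [hj]

omit [TopologicalSpace K] [OrderTopology K] [LinearOrder K] [IsStrictOrderedRing K] in
/-- `Σⱼ gⱼ · (t in the i-th slot)ⱼ = gᵢ t`. [folklore] -/
theorem sum_mul_single (g : Fin n → K) (i : Fin n) (t : K) :
    ∑ j, g j * (Pi.single i t : Fin n → K) j = g i * t := by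
  rw [Finset.sum_eq_single i]
  · simp
  · intro j _ hj; simp [hj]
  · intro h; exact absurd (Finset.mem_univ i) h

omit [TopologicalSpace K] [OrderTopology K] in
/-- `Σⱼ |(t in the i-th slot)ⱼ| = |t|`. [folklore] -/
theorem sum_abs_single (i : Fin n) (t : K) : ∑ j, |(Pi.single i t : Fin n → K) j| = |t| := by
  rw [Finset.sum_eq_single i]
  · simp
  · intro j _ hj; simp [hj]
  · intro h; exact absurd (Finset.mem_univ i) h

/-! ### The gradient consists of the partial derivatives -/

/-- **A differentiable function has partial derivatives, the coordinates of its gradient.**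
[folklore] -/
theorem HasLinDerivAt.hasPartialDerivAt {f : (Fin n → K) → K} {g : Fin n → K} {x : Fin n → K}
    (hf : HasLinDerivAt f g x) (i : Fin n) : HasPartialDerivAt f i (g i) x := by
  rw [hasPartialDerivAt_iff, hasFieldDerivAt_iff, LinearOrderedAddCommGroup.tendsto_nhds]
  intro ε hε
  obtain ⟨δ, hδ, hfδ⟩ := hf (ε / 2) (half_pos hε)
  have hmem : {s : K | |s - x i| < δ} ∈ 𝓝[≠] (x i) :=
    mem_nhdsWithin_of_mem_nhds (eventually_abs_sub_lt (x i) hδ)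
  filter_upwards [hmem, self_mem_nhdsWithin] with s hs hsne
  have hsne' : s - x i ≠ 0 := sub_ne_zero.2 hsne
  have hpos : 0 < |s - x i| := abs_pos.2 hsne'
  -- apply differentiability to `h = (s - x i) eᵢ`
  have h := hfδ (Pi.single i (s - x i)) fun j => by
    by_cases hj : j = i
    · subst hj; simpa using hs
    · simp [hj, hδ]
  rw [add_single_eq_update, sum_mul_single, sum_abs_single, add_sub_cancel] at h
  have hx : update x i (x i) = x := update_eq_self i x
  rw [hx]
  -- `|slope - g i| ≤ ε/2 < ε`
  have hkey : |(f (update x i s) - f x) / (s - x i) - g i| ≤ ε / 2 := by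
    rw [div_sub' hsne', abs_div]
    rw [div_le_iff₀ hpos]
    calc |f (update x i s) - f x - (s - x i) * g i|
        = |f (update x i s) - f x - g i * (s - x i)| := by ring_nf
      _ ≤ ε / 2 * |s - x i| := h
  exact hkey.trans_lt (half_lt_self hε)

/-! ### Differentiable functions are continuous -/

omit [TopologicalSpace K] [OrderTopology K] in
/-- `|Σ gᵢ hᵢ| ≤ (Σ |gᵢ|) · max? ` — the crude bound `|Σ gᵢ hᵢ| ≤ Σ |gᵢ| |hᵢ|`. [folklore] -/
theorem abs_sum_mul_le (g h : Fin n → K) : |∑ i, g i * h i| ≤ ∑ i, |g i| * |h i| := by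
  refine (Finset.abs_sum_le_sum_abs _ _).trans (le_of_eq ?_)
  exact Finset.sum_congr rfl fun i _ => abs_mul _ _

/-- **Differentiable functions are continuous** (for the product of the order topologies).
[folklore] -/
theorem HasLinDerivAt.continuousAt {f : (Fin n → K) → K} {g : Fin n → K} {x : Fin n → K}
    (hf : HasLinDerivAt f g x) : ContinuousAt f x := by
  rw [ContinuousAt, LinearOrderedAddCommGroup.tendsto_nhds]
  intro ε hε
  obtain ⟨δ, hδ, hfδ⟩ := hf 1 one_pos
  -- a uniform coordinate radius `r`
  set G : K := ∑ i, |g i| with hG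
  have hG0 : 0 ≤ G := Finset.sum_nonneg fun i _ => abs_nonneg _
  set r : K := min δ (ε / ((G + 1) * (n + 1))) with hr
  have hden : 0 < (G + 1) * (n + 1) := mul_pos (by linarith) (by exact_mod_cast Nat.succ_pos n)
  have hrpos : 0 < r := lt_min hδ (div_pos hε hden)
  have hmem : (Set.pi univ fun i => {t : K | |t - x i| < r}) ∈ 𝓝 x :=
    set_pi_mem_nhds finite_univ fun i _ => eventually_abs_sub_lt (x i) hrpos
  filter_upwards [hmem] with w hw
  have hwi : ∀ i, |(w - x) i| < r := fun i => by simpa using hw i (mem_univ i)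
  have h := hfδ (w - x) fun i => (hwi i).trans_le (min_le_left _ _)
  rw [add_sub_cancel, one_mul] at h
  -- `|f w - f x| ≤ (G + 1) Σ |wᵢ - xᵢ| ≤ (G + 1) n r < ε`
  have hsum : ∑ i, |(w - x) i| ≤ n * r := by
    calc ∑ i, |(w - x) i| ≤ ∑ _i : Fin n, r := Finset.sum_le_sum fun i _ => (hwi i).le
      _ = n * r := by simp
  have hlin : |∑ i, g i * (w - x) i| ≤ G * r := by
    refine (abs_sum_mul_le _ _).trans ?_
    rw [hG, Finset.sum_mul]
    exact Finset.sum_le_sum fun i _ => mul_le_mul_of_nonneg_left (hwi i).le (abs_nonneg _)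
  have htri : |f w - f x| ≤ |f w - f x - ∑ i, g i * (w - x) i| + |∑ i, g i * (w - x) i| := by
    have := abs_add_le (f w - f x - ∑ i, g i * (w - x) i) (∑ i, g i * (w - x) i)
    rwa [sub_add_cancel] at this
  have hrle : r ≤ ε / ((G + 1) * (n + 1)) := min_le_right _ _
  have hnr : (n : K) * r ≤ n * (ε / ((G + 1) * (n + 1))) :=
    mul_le_mul_of_nonneg_left hrle (Nat.cast_nonneg n)
  have hGr : G * r ≤ G * (ε / ((G + 1) * (n + 1))) := mul_le_mul_of_nonneg_left hrle hG0
  have hkey : (n : K) * (ε / ((G + 1) * (n + 1))) + G * (ε / ((G + 1) * (n + 1))) < ε := by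
    rw [← add_mul, div_eq_mul_inv]
    have h1 : ((n : K) + G) * (ε * ((G + 1) * (n + 1))⁻¹) = ε * ((n + G) / ((G + 1) * (n + 1))) := by
      ring
    rw [h1]
    have h2 : ((n : K) + G) / ((G + 1) * (n + 1)) < 1 := by
      rw [div_lt_one hden]
      nlinarith [Nat.cast_nonneg (α := K) n]
    calc ε * ((n + G) / ((G + 1) * (n + 1))) < ε * 1 := mul_lt_mul_of_pos_left h2 hε
      _ = ε := mul_one ε
  calc |f w - f x| ≤ |f w - f x - ∑ i, g i * (w - x) i| + |∑ i, g i * (w - x) i| := htri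
    _ ≤ ∑ i, |(w - x) i| + G * r := add_le_add h hlin
    _ ≤ n * r + G * r := by linarith
    _ ≤ n * (ε / ((G + 1) * (n + 1))) + G * (ε / ((G + 1) * (n + 1))) := add_le_add hnr hGr
    _ < ε := hkey

/-! ### Linearity -/

omit [TopologicalSpace K] [OrderTopology K] in
/-- Constants are differentiable with gradient `0`. [folklore] -/
theorem hasLinDerivAt_const (c : K) (x : Fin n → K) : HasLinDerivAt (fun _ => c) 0 x := by
  intro ε hε
  refine ⟨1, one_pos, fun h _ => ?_⟩
  simp only [Pi.zero_apply, zero_mul, Finset.sum_const_zero, sub_self, abs_zero]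
  exact mul_nonneg hε.le (Finset.sum_nonneg fun i _ => abs_nonneg _)

omit [TopologicalSpace K] [OrderTopology K] in
/-- Sum rule. [folklore] -/
theorem HasLinDerivAt.add {f₁ f₂ : (Fin n → K) → K} {g₁ g₂ : Fin n → K} {x : Fin n → K}
    (h₁ : HasLinDerivAt f₁ g₁ x) (h₂ : HasLinDerivAt f₂ g₂ x) :
    HasLinDerivAt (fun y => f₁ y + f₂ y) (g₁ + g₂) x := by
  intro ε hε
  obtain ⟨δ₁, hδ₁, hf₁⟩ := h₁ (ε / 2) (half_pos hε)
  obtain ⟨δ₂, hδ₂, hf₂⟩ := h₂ (ε / 2) (half_pos hε)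
  refine ⟨min δ₁ δ₂, lt_min hδ₁ hδ₂, fun h hh => ?_⟩
  have e₁ := hf₁ h fun i => (hh i).trans_le (min_le_left _ _)
  have e₂ := hf₂ h fun i => (hh i).trans_le (min_le_right _ _)
  have hsplit : f₁ (x + h) + f₂ (x + h) - (f₁ x + f₂ x) - ∑ i, (g₁ + g₂) i * h i =
      (f₁ (x + h) - f₁ x - ∑ i, g₁ i * h i) + (f₂ (x + h) - f₂ x - ∑ i, g₂ i * h i) := by
    simp only [Pi.add_apply, add_mul, Finset.sum_add_distrib]
    ring
  rw [hsplit]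
  refine (abs_add_le _ _).trans ?_
  linarith

omit [TopologicalSpace K] [OrderTopology K] in
/-- Scalar multiples. [folklore] -/
theorem HasLinDerivAt.const_mul {f : (Fin n → K) → K} {g : Fin n → K} {x : Fin n → K}
    (hf : HasLinDerivAt f g x) (c : K) :
    HasLinDerivAt (fun y => c * f y) (fun i => c * g i) x := by
  intro ε hε
  have hc1 : 0 < |c| + 1 := add_pos_of_nonneg_of_pos (abs_nonneg c) one_pos
  obtain ⟨δ, hδ, hfδ⟩ := hf (ε / (|c| + 1)) (div_pos hε hc1)
  refine ⟨δ, hδ, fun h hh => ?_⟩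
  have e := hfδ h hh
  have hsplit : c * f (x + h) - c * f x - ∑ i, c * g i * h i =
      c * (f (x + h) - f x - ∑ i, g i * h i) := by
    simp only [mul_sub, Finset.mul_sum, mul_assoc]
  rw [hsplit, abs_mul]
  have hS : 0 ≤ ∑ i, |h i| := Finset.sum_nonneg fun i _ => abs_nonneg _
  calc |c| * |f (x + h) - f x - ∑ i, g i * h i| ≤ |c| * (ε / (|c| + 1) * ∑ i, |h i|) :=
        mul_le_mul_of_nonneg_left e (abs_nonneg c)
    _ = (|c| / (|c| + 1)) * (ε * ∑ i, |h i|) := by ring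
    _ ≤ 1 * (ε * ∑ i, |h i|) := by
        refine mul_le_mul_of_nonneg_right ?_ (mul_nonneg hε.le hS)
        rw [div_le_one hc1]
        exact le_add_of_nonneg_right zero_le_one
    _ = ε * ∑ i, |h i| := one_mul _

/-! ### The chain rule along a curve -/

/-- **The chain rule along a curve**: if each coordinate of `γ : K → Kⁿ` has derivative `γ'ᵢ`
at `t₀` and `f` is differentiable at `γ t₀` with gradient `g`, then `t ↦ f (γ t)` has
derivative `Σ gᵢ γ'ᵢ` at `t₀`. [folklore] -/
theorem HasLinDerivAt.comp_curve {f : (Fin n → K) → K} {g : Fin n → K} {γ : K → (Fin n → K)}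
    {γ' : Fin n → K} {t₀ : K} (hf : HasLinDerivAt f g (γ t₀))
    (hγ : ∀ i, HasFieldDerivAt (fun t => γ t i) (γ' i) t₀) :
    HasFieldDerivAt (fun t => f (γ t)) (∑ i, g i * γ' i) t₀ := by
  rw [hasFieldDerivAt_iff, LinearOrderedAddCommGroup.tendsto_nhds]
  intro ε hε
  -- constants
  set G : K := ∑ i, |g i| with hG
  have hG0 : 0 ≤ G := Finset.sum_nonneg fun i _ => abs_nonneg _
  set S : K := ∑ i, (|γ' i| + 1) with hS
  have hS0 : 0 ≤ S := Finset.sum_nonneg fun i _ => add_nonneg (abs_nonneg _) zero_le_one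
  have hS1 : 0 < S + 1 := add_pos_of_nonneg_of_pos hS0 one_pos
  have hG1 : 0 < G + 1 := add_pos_of_nonneg_of_pos hG0 one_pos
  set η : K := ε / (2 * (S + 1)) with hη
  have hηpos : 0 < η := div_pos hε (mul_pos two_pos hS1)
  set θ : K := min 1 (ε / (2 * (G + 1))) with hθ
  have hθpos : 0 < θ := lt_min one_pos (div_pos hε (mul_pos two_pos hG1))
  obtain ⟨δ, hδ, hfδ⟩ := hf η hηpos
  -- eventually: coordinate slopes close to `γ'ᵢ`, and coordinates close to `γ t₀ i`
  have hslope : ∀ i, ∀ᶠ t in 𝓝[≠] t₀, |(γ t i - γ t₀ i) / (t - t₀) - γ' i| < θ := by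
    intro i
    have h := hγ i
    rw [hasFieldDerivAt_iff, LinearOrderedAddCommGroup.tendsto_nhds] at h
    exact h θ hθpos
  have hnear : ∀ i, ∀ᶠ t in 𝓝[≠] t₀, |γ t i - γ t₀ i| < δ := by
    intro i
    have hc := (hγ i).continuousAt
    rw [ContinuousAt, LinearOrderedAddCommGroup.tendsto_nhds] at hc
    exact (hc δ hδ).filter_mono nhdsWithin_le_nhds
  have hall₁ := Filter.eventually_all.2 hslope
  have hall₂ := Filter.eventually_all.2 hnear
  filter_upwards [hall₁, hall₂, self_mem_nhdsWithin] with t ht₁ ht₂ htne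
  have htne' : t - t₀ ≠ 0 := sub_ne_zero.2 htne
  have hpos : 0 < |t - t₀| := abs_pos.2 htne'
  -- notation
  set d : Fin n → K := fun i => γ t i - γ t₀ i with hd
  set sl : Fin n → K := fun i => (γ t i - γ t₀ i) / (t - t₀) with hsl
  have hdsl : ∀ i, d i = sl i * (t - t₀) := fun i => by
    show γ t i - γ t₀ i = (γ t i - γ t₀ i) / (t - t₀) * (t - t₀)
    rw [div_mul_cancel₀ _ htne']
  -- the remainder of differentiability at `γ t₀` along `d`
  have hR := hfδ d fun i => ht₂ i
  have hγt : γ t₀ + d = γ t := by funext i; simp [hd]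
  rw [hγt] at hR
  -- bound on the slopes
  have hslb : ∀ i, |sl i| ≤ |γ' i| + 1 := by
    intro i
    have h1 : |sl i - γ' i| < 1 := (ht₁ i).trans_le (min_le_left _ _)
    have := abs_sub_abs_le_abs_sub (sl i) (γ' i)
    linarith
  -- decomposition of the slope of `f ∘ γ`
  have hdecomp : (f (γ t) - f (γ t₀)) / (t - t₀) - ∑ i, g i * γ' i =
      (f (γ t) - f (γ t₀) - ∑ i, g i * d i) / (t - t₀) + ∑ i, g i * (sl i - γ' i) := by
    have h1 : ∑ i, g i * d i = (∑ i, g i * sl i) * (t - t₀) := by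
      rw [Finset.sum_mul]
      exact Finset.sum_congr rfl fun i _ => by rw [hdsl i]; ring
    have h2 : ∑ i, g i * (sl i - γ' i) = ∑ i, g i * sl i - ∑ i, g i * γ' i := by
      rw [← Finset.sum_sub_distrib]
      exact Finset.sum_congr rfl fun i _ => by ring
    rw [h1, h2]
    field_simp
    ring
  rw [hdecomp]
  -- first term: `≤ η Σ |dᵢ| / |t - t₀| = η Σ |slᵢ| ≤ η S`
  have hfirst : |(f (γ t) - f (γ t₀) - ∑ i, g i * d i) / (t - t₀)| ≤ η * S := by
    rw [abs_div, div_le_iff₀ hpos]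
    refine hR.trans ?_
    have hsum : ∑ i, |d i| = (∑ i, |sl i|) * |t - t₀| := by
      rw [Finset.sum_mul]
      exact Finset.sum_congr rfl fun i _ => by rw [hdsl i, abs_mul]
    rw [hsum, ← mul_assoc]
    refine mul_le_mul_of_nonneg_right ?_ hpos.le
    exact mul_le_mul_of_nonneg_left (Finset.sum_le_sum fun i _ => hslb i) hηpos.le
  -- second term: `≤ Σ |gᵢ| θ ≤ G ε / (2 (G + 1))`
  have hsecond : |∑ i, g i * (sl i - γ' i)| ≤ G * θ := by
    refine (abs_sum_mul_le _ _).trans ?_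
    rw [hG, Finset.sum_mul]
    exact Finset.sum_le_sum fun i _ => mul_le_mul_of_nonneg_left (ht₁ i).le (abs_nonneg _)
  have hηS : η * S < ε / 2 := by
    rw [hη]
    have h1 : ε / (2 * (S + 1)) * S = ε / 2 * (S / (S + 1)) := by
      field_simp
    rw [h1]
    have h2 : S / (S + 1) < 1 := by rw [div_lt_one hS1]; exact lt_add_one S
    calc ε / 2 * (S / (S + 1)) < ε / 2 * 1 := mul_lt_mul_of_pos_left h2 (half_pos hε)
      _ = ε / 2 := mul_one _
  have hGθ : G * θ ≤ ε / 2 := by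
    calc G * θ ≤ G * (ε / (2 * (G + 1))) := mul_le_mul_of_nonneg_left (min_le_right _ _) hG0
      _ = ε / 2 * (G / (G + 1)) := by field_simp
      _ ≤ ε / 2 * 1 := by
          refine mul_le_mul_of_nonneg_left ?_ (half_pos hε).le
          rw [div_le_one hG1]; exact le_add_of_nonneg_right zero_le_one
      _ = ε / 2 := mul_one _
  calc |(f (γ t) - f (γ t₀) - ∑ i, g i * d i) / (t - t₀) + ∑ i, g i * (sl i - γ' i)|
      ≤ |(f (γ t) - f (γ t₀) - ∑ i, g i * d i) / (t - t₀)| + |∑ i, g i * (sl i - γ' i)| :=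
        abs_add_le _ _
    _ ≤ η * S + G * θ := add_le_add hfirst hsecond
    _ < ε / 2 + ε / 2 := add_lt_add_of_lt_of_le hηS hGθ
    _ = ε := add_halves ε

end Literature.ModelTheory.ExponentialFields
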